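import Summits.ResolutionOfSingularities.ResolutionOfSingularities.Theorems.HilbertSamuelEliminationK42Specimens
import Mathlib.Algebra.CharP.Lemmas
import Mathlib.Tactic.Ring
import HarnessLib

/-!
# K4.2 specimens, continued: the torus translates of `γ` inside `Sing X₂` (W-Q fourfold, `p = 2`)

Successor-seat addendum (cell `res-hironaka`, seat `res-L0-k42`, 2026-08-27) to
`HilbertSamuelEliminationK42Specimens.lean` (same namespace, same specimen `fWQ` and its reduced
partials `fWQy`, `fWQz`, `fWQw`). The W-Q polynomial
`f = x² + wv⁶ + zw⁵v² + yz²wv⁴ + yz³w⁵ + yz⁹ + y⁴zw²v² + y¹¹` is quasi-homogeneous for the weights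
`(99, 18, 20, 24, 29)`, so `Sing X₂` is stable under `t · (x,y,z,w,v) = (t⁹⁹x, t¹⁸y, t²⁰z, t²⁴w, t²⁹v)`
and the orbit closure of a point with `y, z, w, v ≠ 0` is a translate of
`γ(t) = (t⁹⁹, t¹⁸, t²⁰, t²⁴, t²⁹)`. For the normalised translates
`Γ_c(t) = (c² t⁹⁹, t¹⁸, t²⁰, c t²⁴, c t²⁹)` (the point `(c², 1, 1, c, c)` moved by the torus;
`x = c² t⁹⁹` is what `x² = g` forces in characteristic `2`) the four polynomials cutting out
`Sing X₂ = V(f, ∂f/∂y, ∂f/∂z, ∂f/∂w)` (`∂f/∂x = ∂f/∂v = 0`, `pderiv_fWQ_x` / `pderiv_fWQ_v`)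
evaluate, over ANY commutative ring, to `2(c⁷+c⁵+c⁴+1)·t¹⁹⁸`, `2(c⁵+1)·t¹⁸⁰`,
`(c⁷+c⁵+c⁴+1)·t¹⁷⁸`, `2(c⁶+c⁴)·t¹⁷⁴` (`aeval_gammaC_fWQ*`), and
`c⁷+c⁵+c⁴+1 ≡ (c+1)²(c⁵+c²+1) (mod 2)` (`septic_eq_sq_mul_quintic`). Hence in characteristic `2`
the translate `Γ_c` lies in `Sing X₂` exactly when `(c+1)²(c⁵+c²+1) = 0`
(`gammaC_subset_sing`, `aeval_gammaC_fWQz_charTwo`): the double root `c = 1` is `γ` itself, and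
the five roots of the irreducible quintic `c⁵ + c² + 1 ∈ 𝔽₂[c]` give five
`Gal(𝔽₃₂/𝔽₂)`-conjugate translates `Γ_a, Γ_{a²}, Γ_{a⁴}, Γ_{a⁸}, Γ_{a¹⁶}`, `𝔽₃₂ = 𝔽₂[a]/(a⁵+a²+1)`.
This is the kernel side of the CAS-free point count of the cell's seat `res-L0-repro-1` (kit job
j261424: over `𝔽₃₂` the points of `Sing X₂` off the three rational curves — the `w`-axis, the cusp
`C₂ = V(x,y,v,w⁵+z⁶)`, `γ` — form exactly five torus orbits of size `31`, permuted cyclically by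
Frobenius, with representatives `(y,z,w,v) = (1,1,c,c)`, `c⁵+c²+1 = 0`): the component called `C₃`
in the cell's `L/res-L0-k42/KILL-TEST-K4.2.md` §3 splits over `𝔽₃₂`, not over `𝔽₄`/`𝔽₈` as §3a (i)
there had guessed. The parametrisation is written inline (no new definitions). Everything here is
OURS (campaign specimens); nothing is a statement of, or attributed to, the manuscript under review.
AI-produced; weaker than expert review.
-/

set_option linter.dupNamespace false -- mandated namespace of this single-conjunct summit

namespace Summit.ResolutionOfSingularities.ResolutionOfSingularities.Theorems.K42

open MvPolynomial

noncomputable section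

section WQtranslates

/-! ### Evaluations along `Γ_c` (any commutative ring), then characteristic `2` -/

variable (R : Type*) [CommRing R]

/-- `f(Γ_c(t)) = 2(c⁷+c⁵+c⁴+1)·t¹⁹⁸` over any commutative ring (`x² ↦ c⁴t¹⁹⁸`, the seven
monomials of `g` ↦ `(2c⁷+2c⁵+c⁴+2)t¹⁹⁸`). OURS. -/
theorem aeval_gammaC_fWQ (c : R) :
    aeval ![Polynomial.C c ^ 2 * Polynomial.X ^ 99, Polynomial.X ^ 18, Polynomial.X ^ 20,
      Polynomial.C c * Polynomial.X ^ 24, Polynomial.C c * Polynomial.X ^ 29] (fWQ R) =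
      Polynomial.C (2 * (c ^ 7 + c ^ 5 + c ^ 4 + 1)) * Polynomial.X ^ 198 := by
  simp only [fWQ, map_add, map_mul, map_pow, aeval_X, Matrix.cons_val_zero, Matrix.cons_val_one,
    Matrix.cons_val, map_ofNat, map_one]
  ring

/-- `(∂f/∂y)(Γ_c(t)) = 2(c⁵+1)·t¹⁸⁰` over any commutative ring. OURS. -/
theorem aeval_gammaC_fWQy (c : R) :
    aeval ![Polynomial.C c ^ 2 * Polynomial.X ^ 99, Polynomial.X ^ 18, Polynomial.X ^ 20,
      Polynomial.C c * Polynomial.X ^ 24, Polynomial.C c * Polynomial.X ^ 29] (fWQy R) =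
      Polynomial.C (2 * (c ^ 5 + 1)) * Polynomial.X ^ 180 := by
  simp only [fWQy, map_add, map_mul, map_pow, aeval_X, Matrix.cons_val_zero, Matrix.cons_val_one,
    Matrix.cons_val, map_ofNat, map_one]
  ring

/-- `(∂f/∂z)(Γ_c(t)) = (c⁷+c⁵+c⁴+1)·t¹⁷⁸` over any commutative ring — the only one of the four
evaluations not divisible by `2`. OURS. -/
theorem aeval_gammaC_fWQz (c : R) :
    aeval ![Polynomial.C c ^ 2 * Polynomial.X ^ 99, Polynomial.X ^ 18, Polynomial.X ^ 20,
      Polynomial.C c * Polynomial.X ^ 24, Polynomial.C c * Polynomial.X ^ 29] (fWQz R) =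
      Polynomial.C (c ^ 7 + c ^ 5 + c ^ 4 + 1) * Polynomial.X ^ 178 := by
  simp only [fWQz, map_add, map_mul, map_pow, aeval_X, Matrix.cons_val_zero, Matrix.cons_val_one,
    Matrix.cons_val, map_one]
  ring

/-- `(∂f/∂w)(Γ_c(t)) = 2(c⁶+c⁴)·t¹⁷⁴` over any commutative ring. OURS. -/
theorem aeval_gammaC_fWQw (c : R) :
    aeval ![Polynomial.C c ^ 2 * Polynomial.X ^ 99, Polynomial.X ^ 18, Polynomial.X ^ 20,
      Polynomial.C c * Polynomial.X ^ 24, Polynomial.C c * Polynomial.X ^ 29] (fWQw R) =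
      Polynomial.C (2 * (c ^ 6 + c ^ 4)) * Polynomial.X ^ 174 := by
  simp only [fWQw, map_add, map_mul, map_pow, aeval_X, Matrix.cons_val_zero, Matrix.cons_val_one,
    Matrix.cons_val, map_ofNat]
  ring

/-- `c⁷ + c⁵ + c⁴ + 1 + 2(c⁶+c³+c²+c) = (c+1)²(c⁵+c²+1)` over any commutative ring; in
characteristic `2` this reads `c⁷+c⁵+c⁴+1 = (c+1)²(c⁵+c²+1)`, with `c⁵+c²+1` irreducible over
`𝔽₂`. OURS. -/
theorem septic_eq_sq_mul_quintic (c : R) :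
    c ^ 7 + c ^ 5 + c ^ 4 + 1 + 2 * (c ^ 6 + c ^ 3 + c ^ 2 + c) =
      (c + 1) ^ 2 * (c ^ 5 + c ^ 2 + 1) := by
  ring

/-- **In characteristic `2`, every root `c` of `c⁵ + c² + 1` gives a torus translate
`Γ_c(t) = (c²t⁹⁹, t¹⁸, t²⁰, ct²⁴, ct²⁹)` of `γ` inside `Sing X₂ = V(f, ∂_y f, ∂_z f, ∂_w f)`**
(`∂_x f = ∂_v f = 0` identically, `pderiv_fWQ_x` / `pderiv_fWQ_v`): all four evaluations vanish.
Over `𝔽₃₂ = 𝔽₂[a]/(a⁵+a²+1)` these are the five Frobenius-conjugate curves `Γ_a, Γ_{a²}, Γ_{a⁴},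
Γ_{a⁸}, Γ_{a¹⁶}`. OURS. -/
theorem gammaC_subset_sing [CharP R 2] (c : R) (hc : c ^ 5 + c ^ 2 + 1 = 0) :
    aeval ![Polynomial.C c ^ 2 * Polynomial.X ^ 99, Polynomial.X ^ 18, Polynomial.X ^ 20,
        Polynomial.C c * Polynomial.X ^ 24, Polynomial.C c * Polynomial.X ^ 29] (fWQ R) = 0 ∧
      aeval ![Polynomial.C c ^ 2 * Polynomial.X ^ 99, Polynomial.X ^ 18, Polynomial.X ^ 20,
        Polynomial.C c * Polynomial.X ^ 24, Polynomial.C c * Polynomial.X ^ 29] (fWQy R) = 0 ∧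
      aeval ![Polynomial.C c ^ 2 * Polynomial.X ^ 99, Polynomial.X ^ 18, Polynomial.X ^ 20,
        Polynomial.C c * Polynomial.X ^ 24, Polynomial.C c * Polynomial.X ^ 29] (fWQz R) = 0 ∧
      aeval ![Polynomial.C c ^ 2 * Polynomial.X ^ 99, Polynomial.X ^ 18, Polynomial.X ^ 20,
        Polynomial.C c * Polynomial.X ^ 24, Polynomial.C c * Polynomial.X ^ 29] (fWQw R) = 0 := by
  have h2 : (2 : R) = 0 := CharP.cast_eq_zero R 2
  have h7 : c ^ 7 + c ^ 5 + c ^ 4 + 1 = 0 := by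
    have h := septic_eq_sq_mul_quintic R c
    rw [hc, mul_zero, h2, zero_mul, add_zero] at h
    exact h
  refine ⟨?_, ?_, ?_, ?_⟩
  · rw [aeval_gammaC_fWQ, h2, zero_mul, map_zero, zero_mul]
  · rw [aeval_gammaC_fWQy, h2, zero_mul, map_zero, zero_mul]
  · rw [aeval_gammaC_fWQz, h7, map_zero, zero_mul]
  · rw [aeval_gammaC_fWQw, h2, zero_mul, map_zero, zero_mul]

/-- Conversely the translate `Γ₁ = γ` is the double root: `(∂f/∂z)(Γ_c) = (c+1)²(c⁵+c²+1)·t¹⁷⁸` in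
characteristic `2`, so among the normalised translates only `c = 1` and the roots of the quintic
lie in `V(∂f/∂z)`. OURS. -/
theorem aeval_gammaC_fWQz_charTwo [CharP R 2] (c : R) :
    aeval ![Polynomial.C c ^ 2 * Polynomial.X ^ 99, Polynomial.X ^ 18, Polynomial.X ^ 20,
      Polynomial.C c * Polynomial.X ^ 24, Polynomial.C c * Polynomial.X ^ 29] (fWQz R) =
      Polynomial.C ((c + 1) ^ 2 * (c ^ 5 + c ^ 2 + 1)) * Polynomial.X ^ 178 := by
  have h2 : (2 : R) = 0 := CharP.cast_eq_zero R 2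
  rw [aeval_gammaC_fWQz, ← septic_eq_sq_mul_quintic, h2, zero_mul, add_zero]

end WQtranslates

end

end Summit.ResolutionOfSingularities.ResolutionOfSingularities.Theorems.K42
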